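import Literature.MathematicalPhysics.QuantumLattice.LayeredEquilibriumStatesOrderParameterBound
import Literature.MathematicalPhysics.QuantumLattice.HubbardTTPrimeEquilibriumStatesNoPairing
import Literature.MathematicalPhysics.QuantumLattice.OneBandHoppingFamilyMeanEnergyMinimisers
import HarnessLib

/-!
# The stacked `t–t'–t_⊥` Hubbard model on `ℤ³`: the pairing amplitude of every translation-invariant equilibrium state is
# `O(√(β(1/M² · log N + |t_⊥| N²)))` — ordering temperature `≲ 1/log(1/|t_⊥|)`

Topic `Literature/MathematicalPhysics/QuantumLattice` (family `hubbard`; instance of `LayeredEquilibriumStatesOrderParameterBound`).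

The one-band model of weakly coupled `CuO₂`-type layers: on `ℤ³`, nearest-neighbour in-plane hopping `t`, next-nearest (diagonal)
in-plane hopping `t'`, interlayer hopping `t_⊥` along `e₂`, on-site repulsion `U`, chemical potential `μ` — assembled from the tree's
one-band hopping family (`hubbardHoppingFamily`, jump pairs `(e₀,e₁)`, `(e₀+e₁, e₀−e₁)`, `(e₂,e₂)` with amplitudes `t, t', t_⊥/2`) and
the number interaction (`pencil _ (numberInteraction 3) (−μ)`). PROVED here:

* `stackedHubbardInteraction t t' t_⊥ U μ` is even, Hermitian, translation covariant, of range `1`, and each of its terms conserves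
  the particle number (`commute_chargeSum_numberCharge_stacked`);
* `interlayerNorm_stacked_le`: its interlayer coupling norm is `ε_⊥ ≤ 4|t_⊥|` (only the two vertical half-bonds through the origin
  couple different layers; `sum_norm_vectorHopping_through_origin_le`);
* `IsVarEquilibrium.norm_sq_expect_le_stacked`: for every `β ≥ 0`, every translation-invariant equilibrium state `ω`, every local
  `O ∈ 𝔄_Λ`, `Λ ⊆ box ρ₀`, of particle number `κ`, every `a ≥ ρ₀ + 4`, `M > 0`, `N ≥ a e^M`:
  `|κ|²|ω(O)|² ≤ β‖O‖² · 4‖q‖² · 27(2ρ₀+1) · [S_Ψ · 32(1 + log(N+ρ₀+1))/M² + 4|t_⊥| (2N+1)²]`;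
* `IsVarEquilibrium.norm_sq_expect_pair_le_stacked`: the pairing amplitude, `4|ω(c_p c_q)|² ≤ β · (same bracket)`.
  Choosing `e^{2M} ≍ |t_⊥|^{-1/2}` the bracket is `O(1/log(1/|t_⊥|))` for `|t_⊥| → 0`: a pairing amplitude of size `m₀` forces
  `β ≳ m₀² log(1/|t_⊥|)`, i.e. the superconducting `T_c` of weakly coupled Hubbard layers is at most `O(1/log(1/|t_⊥|))` — the
  rigorous (Klein–Landau–Shucker / Mermin–Wagner) form of the quasi-two-dimensional `T_c` estimate.

No named fact; the in-plane norm `S_Ψ = Σ_{X∋0}‖Φ(X)‖` and `‖q‖` (`q = n_↑ + n_↓` at the origin) are left symbolic.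

## References

* A. Klein, L. J. Landau, D. S. Shucker, J. Stat. Phys. 26 (1981) 505–512. [cite: KleinLandauShucker1981]
* T. Koma, H. Tasaki, Phys. Rev. Lett. 68 (1992) 3248 (no pairing LRO in low-dimensional Hubbard models). [cite: KomaTasakiPRL1992, p. 3]
* E. Pavarini et al., Phys. Rev. Lett. 87 (2001) 047003, eq. (1) (one-band models). [cite: PavariniEtAl2001, eq. (1)]
* H. Araki, H. Moriya, Rev. Math. Phys. 15 (2003) 93, Thm. 12.11. [cite: ArakiMoriya2003, Theorem 12.11]
-/

noncomputable section

open scoped ComplexOrder BigOperators Matrix.Norms.L2Operator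
open Finset Literature.InformationTheory.Entropy

namespace Literature.MathematicalPhysics.QuantumLattice

open Matrix Literature.Probability.LatticeModels ThermodynamicLimit LiebThm1 HubbardWave0
open _root_.Filter
open scoped _root_.Topology

/-! ### §1 Vertical hopping through the origin: at most two half-bonds, `Σ ‖Φ_v(X)‖ ≤ 4|t|` -/

section VectorHopping

variable {d : ℕ} {v : Site d} (hv : v ≠ 0) (t : ℝ)
include hv

omit hv in
/-- Distinct sites give distinct orbitals of equal spin. [cite: PavariniEtAl2001, eq. (1)] -/
private theorem orb_pt_ne {Λ : Finset (Site d)} {x y : Site d} (hx : x ∈ Λ) (hy : y ∈ Λ) (hxy : x ≠ y) (σ : Fin 2) :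
    orb (PolySite.pt x hx) σ ≠ orb (PolySite.pt y hy) σ := by
  intro h
  have h1 := (orb_inj.1 h).1
  have h2 := congrArg (fun p : PolySite Λ => ofLex p.1) h1
  simp only [PolySite.ofLex_coe_pt] at h2
  exact hxy h2

/-- **A bond term has norm `≤ 2|t|`.** [cite: KomaTasakiPRL1992, eq. (11) remark] -/
theorem norm_vectorHopping_pair_le (x : Site d) : ‖(vectorHoppingFermionInteraction d v t).Φ {x, x + v}‖ ≤ 2 * |t| := by
  rw [vectorHoppingFermionInteraction_apply_pair hv]
  exact norm_hoppingTerm_le_two_mul t _ _ fun σ => orb_pt_ne _ _ (self_ne_add_of_ne_zero x hv) σ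

/-- **At most two bond classes pass through the origin**: for any family `F` of regions containing `0`,
`Σ_{X ∈ F} ‖Φ_v^{t}(X)‖ ≤ 4|t|` (the only nonzero terms are `{0, v}` and `{−v, 0}`). [cite: PavariniEtAl2001, eq. (1)] -/
theorem sum_norm_vectorHopping_through_origin_le (F : Finset (Finset (Site d))) (hF : ∀ X ∈ F, (0 : Site d) ∈ X) :
    ∑ X ∈ F, ‖(vectorHoppingFermionInteraction d v t).Φ X‖ ≤ 4 * |t| := by
  classical
  set A : Finset (Site d) := {0, 0 + v} with hA
  set B : Finset (Site d) := {-v, -v + v} with hB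
  have hAB : A ≠ B := pair_zero_ne_pair_neg hv
  -- outside `{A, B}` the terms through the origin vanish
  have hzero : ∀ X ∈ F, X ≠ A → X ≠ B → (vectorHoppingFermionInteraction d v t).Φ X = 0 := by
    intro X hX hXA hXB
    refine vectorHoppingFermionInteraction_apply_eq_zero t fun x hx => ?_
    have h0 := hF X hX
    rw [hx, Finset.mem_insert, Finset.mem_singleton] at h0
    rcases h0 with h0 | h0
    · exact hXA (by rw [hx, ← h0])
    · have : x = -v := by rw [eq_neg_iff_add_eq_zero, ← h0]
      exact hXB (by rw [hx, this])
  calc ∑ X ∈ F, ‖(vectorHoppingFermionInteraction d v t).Φ X‖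
      ≤ ∑ X ∈ F ∪ {A, B}, ‖(vectorHoppingFermionInteraction d v t).Φ X‖ :=
        Finset.sum_le_sum_of_subset_of_nonneg Finset.subset_union_left fun _ _ _ => norm_nonneg _
    _ = ∑ X ∈ ({A, B} : Finset (Finset (Site d))), ‖(vectorHoppingFermionInteraction d v t).Φ X‖ := by
        refine (Finset.sum_subset Finset.subset_union_right fun X hX hX' => ?_).symm
        rw [Finset.mem_insert, Finset.mem_singleton, not_or] at hX'
        rw [Finset.mem_union] at hX
        rcases hX with hX | hX
        · rw [hzero X hX hX'.1 hX'.2, norm_zero]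
        · exact absurd hX (by rw [Finset.mem_insert, Finset.mem_singleton, not_or]; exact hX')
    _ = ‖(vectorHoppingFermionInteraction d v t).Φ A‖ + ‖(vectorHoppingFermionInteraction d v t).Φ B‖ := Finset.sum_pair hAB
    _ ≤ 2 * |t| + 2 * |t| := add_le_add (norm_vectorHopping_pair_le hv t 0) (norm_vectorHopping_pair_le hv t (-v))
    _ = 4 * |t| := by ring

omit hv in
/-- Every term of the hopping interaction along `v` preserves the `(N↑, N↓)` sectors. [cite: LiebPRL1989, eqs. (1)–(2)] -/
theorem preservesSectors_vectorHoppingFermionInteraction (Z : Finset (Site d)) :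
    PreservesSectors ((vectorHoppingFermionInteraction d v t).Φ Z) := by
  unfold vectorHoppingFermionInteraction
  simp only [cAt, annihilation_conjTranspose]
  exact PreservesSectors.sum fun x _ => PreservesSectors.sum fun y _ =>
    ((PreservesSectors.sum fun σ _ => (preservesSectors_hopping _ _ σ).add (preservesSectors_hopping _ _ σ)).smul _).ite _

omit hv in
/-- A bond `{x, x + v}` with `v₂ = 0` lies in one layer (`d = 3`). [cite: KleinLandauShucker1981] -/
theorem isSingleLayer_pair_add {v : Site 3} (hv2 : v 2 = 0) (x : Site 3) : IsSingleLayer ({x, x + v} : Finset (Site 3)) := by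
  intro y hy z hz
  rw [Finset.mem_insert, Finset.mem_singleton] at hy hz
  have hx : (x + v) 2 = x 2 := by rw [Pi.add_apply, hv2, add_zero]
  rcases hy with rfl | rfl <;> rcases hz with rfl | rfl
  · rfl
  · rw [hx]
  · rw [hx]
  · rfl

omit hv in
/-- A singleton lies in one layer. [cite: KleinLandauShucker1981] -/
theorem isSingleLayer_singleton (x : Site 3) : IsSingleLayer ({x} : Finset (Site 3)) := by
  intro y hy z hz
  rw [Finset.mem_singleton] at hy hz
  rw [hy, hz]

end VectorHopping

/-! ### §2 The stacked `t–t'–t_⊥` Hubbard interaction on `ℤ³` -/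

/-- First jump vectors of the three bond-class pairs: `e₀`, `e₀ + e₁`, `e₂`. [cite: PavariniEtAl2001, eq. (1)] -/
def stackJump₁ : Fin 3 → Site 3 := ![unitVec 0, unitVec 0 + unitVec 1, unitVec 2]

/-- Second jump vectors: `e₁`, `e₀ − e₁`, `e₂`. [cite: PavariniEtAl2001, eq. (1)] -/
def stackJump₂ : Fin 3 → Site 3 := ![unitVec 1, unitVec 0 - unitVec 1, unitVec 2]

/-- Amplitudes `(t, t', t_⊥/2)` (the vertical pair `(e₂, e₂)` counts the vertical bonds twice). [cite: PavariniEtAl2001, eq. (1)] -/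
def stackAmplitude (t t' tp : ℝ) : Fin 3 → ℝ := ![t, t', tp / 2]

/-- **The stacked `t–t'–t_⊥` Hubbard interaction with chemical potential `μ` on `ℤ³`**:
`Φ^{0,U} + t Φ_{e₀,e₁} + t' Φ_{e₀+e₁, e₀−e₁} + (t_⊥/2) Φ_{e₂,e₂} − μ n`. [cite: PavariniEtAl2001, eq. (1)] -/
def stackedHubbardInteraction (t t' tp U μ : ℝ) : FermionInteraction 3 :=
  FermionInteraction.pencil (hubbardHoppingFamily stackJump₁ stackJump₂ U (stackAmplitude t t' tp)) (numberInteraction 3) (-μ)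

section Stacked

variable (t t' tp U μ : ℝ)

/-- All jump vectors are nonzero. [cite: PavariniEtAl2001, eq. (1)] -/
theorem stackJump_ne_zero (a : Fin 3) : stackJump₁ a ≠ 0 ∧ stackJump₂ a ≠ 0 := by
  fin_cases a
  · refine ⟨fun h => ?_, fun h => ?_⟩
    · have := congr_fun h 0; simp [stackJump₁] at this
    · have := congr_fun h 1; simp [stackJump₂] at this
  · refine ⟨fun h => ?_, fun h => ?_⟩
    · have := congr_fun h 0; simp [stackJump₁] at this
    · have := congr_fun h 0; simp [stackJump₂, Pi.sub_apply] at this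
  · refine ⟨fun h => ?_, fun h => ?_⟩
    · have := congr_fun h 2; simp [stackJump₁] at this
    · have := congr_fun h 2; simp [stackJump₂] at this

/-- All jump vectors have sup norm `≤ 1`. [cite: PavariniEtAl2001, eq. (1)] -/
theorem norm_stackJump_le_one (a : Fin 3) : ‖stackJump₁ a‖ ≤ 1 ∧ ‖stackJump₂ a‖ ≤ 1 := by
  have key : ∀ w : Site 3, (∀ i, w i = 0 ∨ w i = 1 ∨ w i = -1) → ‖w‖ ≤ 1 := by
    intro w hw
    refine (pi_norm_le_iff_of_nonneg zero_le_one).2 fun i => ?_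
    rcases hw i with h | h | h <;> simp [h]
  fin_cases a
  · exact ⟨key _ fun i => by fin_cases i <;> simp [stackJump₁], key _ fun i => by fin_cases i <;> simp [stackJump₂]⟩
  · exact ⟨key _ fun i => by fin_cases i <;> simp [stackJump₁], key _ fun i => by fin_cases i <;> simp [stackJump₂]⟩
  · exact ⟨key _ fun i => by fin_cases i <;> simp [stackJump₁], key _ fun i => by fin_cases i <;> simp [stackJump₂]⟩

/-- The stacked interaction is even. [cite: ArakiMoriya2003, §1 assumption (II)] -/
theorem stackedHubbardInteraction_isEven : (stackedHubbardInteraction t t' tp U μ).IsEven :=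
  FermionInteraction.isEven_pencil (hubbardHoppingFamily_isEven _ _ _ _) numberInteraction_isEven _

/-- The stacked interaction is Hermitian. [cite: ArakiMoriya2003, §1 assumption (II)] -/
theorem stackedHubbardInteraction_isHermitian : (stackedHubbardInteraction t t' tp U μ).IsHermitian :=
  FermionInteraction.isHermitian_pencil (hubbardHoppingFamily_isHermitian _ _ _ _) numberInteraction_isHermitian _

/-- The stacked interaction is translation covariant. [cite: ArakiMoriya2003, §1 assumption (IV) and §8] -/
theorem stackedHubbardInteraction_isTranslationInvariant : (stackedHubbardInteraction t t' tp U μ).IsTranslationInvariant :=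
  FermionInteraction.isTranslationInvariant_pencil (hubbardHoppingFamily_isTranslationInvariant stackJump_ne_zero U _)
    numberInteraction_isTranslationInvariant _

/-- The stacked interaction has range `1`. [cite: ArakiMoriya2003, §5.4 (finite range potentials)] -/
theorem stackedHubbardInteraction_hasFiniteRange : (stackedHubbardInteraction t t' tp U μ).HasFiniteRange 1 :=
  FermionInteraction.hasFiniteRange_pencil (hubbardHoppingFamily_hasFiniteRange zero_le_one norm_stackJump_le_one U _)
    (numberInteraction_hasFiniteRange 1 zero_le_one) _

/-- The terms of the stacked interaction (definitional unfolding). [cite: PavariniEtAl2001, eq. (1)] -/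
theorem stackedHubbardInteraction_apply (X : Finset (Site 3)) :
    (stackedHubbardInteraction t t' tp U μ).Φ X =
      (hubbardFermionInteraction 3 0 U).Φ X +
        (((t : ℝ) : ℂ) • ((vectorHoppingFermionInteraction 3 (unitVec 0) 1).Φ X + (vectorHoppingFermionInteraction 3 (unitVec 1) 1).Φ X) +
          ((t' : ℝ) : ℂ) • ((vectorHoppingFermionInteraction 3 (unitVec 0 + unitVec 1) 1).Φ X +
              (vectorHoppingFermionInteraction 3 (unitVec 0 - unitVec 1) 1).Φ X) +
            ((tp / 2 : ℝ) : ℂ) • ((vectorHoppingFermionInteraction 3 (unitVec 2) 1).Φ X +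
              (vectorHoppingFermionInteraction 3 (unitVec 2) 1).Φ X)) +
        ((-μ : ℝ) : ℂ) • (numberInteraction 3).Φ X := by
  rw [stackedHubbardInteraction, FermionInteraction.pencil_apply, hubbardHoppingFamily, FermionInteraction.linearFamily_apply,
    Fin.sum_univ_three]
  simp only [hoppingPairInteraction_apply, stackJump₁, stackJump₂, stackAmplitude, Matrix.cons_val_zero, Matrix.cons_val_one,
    Matrix.cons_val_two, Matrix.tail_cons, Matrix.head_cons]

/-- **Every term of the stacked interaction preserves the `(N↑, N↓)` sectors.** [cite: LiebPRL1989, eqs. (1)–(2)] -/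
theorem preservesSectors_stackedHubbardInteraction (Z : Finset (Site 3)) :
    PreservesSectors ((stackedHubbardInteraction t t' tp U μ).Φ Z) := by
  rw [stackedHubbardInteraction_apply]
  have hA : PreservesSectors ((vectorHoppingFermionInteraction 3 (unitVec 0) 1).Φ Z + (vectorHoppingFermionInteraction 3 (unitVec 1) 1).Φ Z) :=
    (preservesSectors_vectorHoppingFermionInteraction 1 Z).add (preservesSectors_vectorHoppingFermionInteraction 1 Z)
  have hB : PreservesSectors ((vectorHoppingFermionInteraction 3 (unitVec 0 + unitVec 1) 1).Φ Z +
      (vectorHoppingFermionInteraction 3 (unitVec 0 - unitVec 1) 1).Φ Z) :=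
    (preservesSectors_vectorHoppingFermionInteraction 1 Z).add (preservesSectors_vectorHoppingFermionInteraction 1 Z)
  have hC : PreservesSectors ((vectorHoppingFermionInteraction 3 (unitVec 2) 1).Φ Z + (vectorHoppingFermionInteraction 3 (unitVec 2) 1).Φ Z) :=
    (preservesSectors_vectorHoppingFermionInteraction 1 Z).add (preservesSectors_vectorHoppingFermionInteraction 1 Z)
  exact ((preservesSectors_hubbardFermionInteraction 0 U Z).add (((hA.smul _).add (hB.smul _)).add (hC.smul _))).add
    ((preservesSectors_numberInteraction Z).smul _)

/-- **The stacked interaction conserves the particle number, term by term.** [cite: LiebPRL1989, eqs. (1)–(2)] -/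
theorem commute_chargeSum_numberCharge_stacked (Z : Finset (Site 3)) :
    Commute (chargeSum (numberCharge 3) Z) ((stackedHubbardInteraction t t' tp U μ).Φ Z) := by
  rw [chargeSum_numberCharge, totalNumber_eq_diagonal]
  exact ((preservesSectors_stackedHubbardInteraction t t' tp U μ Z).commute_diagonal fun a b => ((a + b : ℕ) : ℂ)).symm

/-- The hopping-free Hubbard interaction `Φ^{0,U}` vanishes off singletons. [cite: arXiv9311033, §2 (the Hubbard Hamiltonian)] -/
theorem hubbardFermionInteraction_zero_apply_of_ne_singleton {d : ℕ} (U : ℝ) {X : Finset (Site d)} (h1 : ∀ x : Site d, X ≠ {x}) :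
    (hubbardFermionInteraction d 0 U).Φ X = 0 := by
  by_cases hb : ∃ (x : Site d) (i : Fin d), X = {x, x + unitVec i}
  · obtain ⟨x, i, rfl⟩ := hb
    rw [hubbardFermionInteraction_apply_pair, Complex.ofReal_zero, neg_zero, zero_smul]
  · exact hubbardFermionInteraction_apply_eq_zero 0 U h1 fun x i hx => hb ⟨x, i, hx⟩

/-- **Off the layers only the vertical bonds act**: on a region NOT contained in one layer the stacked interaction reduces to
`t_⊥ Φ_{e₂}^{1}`. [cite: PavariniEtAl2001, eq. (1)] -/
theorem stackedHubbardInteraction_apply_of_not_isSingleLayer {X : Finset (Site 3)} (hX : ¬ IsSingleLayer X) :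
    (stackedHubbardInteraction t t' tp U μ).Φ X = ((tp : ℝ) : ℂ) • (vectorHoppingFermionInteraction 3 (unitVec 2) 1).Φ X := by
  have h1 : ∀ x : Site 3, X ≠ {x} := fun x hx => hX (hx ▸ isSingleLayer_singleton x)
  have h2 : ∀ {w : Site 3}, w 2 = 0 → ∀ x : Site 3, X ≠ {x, x + w} := fun hw x hx => hX (hx ▸ isSingleLayer_pair_add hw x)
  have e0 : (unitVec 0 : Site 3) 2 = 0 := by simp
  have e1 : (unitVec 1 : Site 3) 2 = 0 := by simp
  have e01 : (unitVec 0 + unitVec 1 : Site 3) 2 = 0 := by simp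
  have e01' : (unitVec 0 - unitVec 1 : Site 3) 2 = 0 := by simp
  rw [stackedHubbardInteraction_apply, hubbardFermionInteraction_zero_apply_of_ne_singleton U h1,
    vectorHoppingFermionInteraction_apply_eq_zero 1 (h2 e0), vectorHoppingFermionInteraction_apply_eq_zero 1 (h2 e1),
    vectorHoppingFermionInteraction_apply_eq_zero 1 (h2 e01), vectorHoppingFermionInteraction_apply_eq_zero 1 (h2 e01'),
    numberInteraction_apply_eq_zero h1, add_zero, smul_zero, smul_zero, smul_zero, zero_add, zero_add, zero_add, add_zero,
    ← two_smul ℂ, smul_smul]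
  congr 1
  push_cast
  ring

/-! ### §3 The interlayer norm and the order-parameter bound -/

/-- **`ε_⊥ ≤ 4|t_⊥|`**: the interlayer coupling norm of the stacked model is at most `4|t_⊥|` (two vertical half-bonds through the
origin, each of norm `≤ 2|t_⊥|`). [cite: KleinLandauShucker1981] [cite: PavariniEtAl2001, eq. (1)] -/
theorem interlayerNorm_stacked_le (R : ℝ) : (stackedHubbardInteraction t t' tp U μ).interlayerNorm R ≤ 4 * |tp| := by
  classical
  unfold FermionInteraction.interlayerNorm
  have e : ∀ Z ∈ ((thicken ({0} : Finset (Site 3)) R).powerset.filter fun Z => (0 : Site 3) ∈ Z ∧ ¬ IsSingleLayer Z),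
      ‖(stackedHubbardInteraction t t' tp U μ).Φ Z‖ = |tp| * ‖(vectorHoppingFermionInteraction 3 (unitVec 2) 1).Φ Z‖ := by
    intro Z hZ
    rw [Finset.mem_filter] at hZ
    rw [stackedHubbardInteraction_apply_of_not_isSingleLayer t t' tp U μ hZ.2.2, norm_smul, Complex.norm_real, Real.norm_eq_abs]
  rw [Finset.sum_congr rfl e, ← Finset.mul_sum]
  have h4 := sum_norm_vectorHopping_through_origin_le (stackJump_ne_zero 2).1 1
    ((thicken ({0} : Finset (Site 3)) R).powerset.filter fun Z => (0 : Site 3) ∈ Z ∧ ¬ IsSingleLayer Z)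
    fun X hX => (Finset.mem_filter.1 hX).2.1
  rw [abs_one, mul_one] at h4
  calc |tp| * _ ≤ |tp| * 4 := mul_le_mul_of_nonneg_left h4 (abs_nonneg _)
    _ = 4 * |tp| := mul_comm _ _

variable {β : ℝ} (hβ : 0 ≤ β) {ω : InfVolFermionState 3}
include hβ

/-- **ORDER-PARAMETER BOUND FOR THE STACKED HUBBARD MODEL.** For every `β ≥ 0`, every translation-invariant equilibrium state `ω`
of the stacked `t–t'–t_⊥` Hubbard model at chemical potential `μ`, every local `O ∈ 𝔄_Λ`, `Λ ⊆ box ρ₀`, with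
`N_Λ O − O N_Λ = κ O`, every `a ≥ ρ₀ + 4`, `M > 0` and `N ≥ a e^M`:
`|κ|²|ω(O)|² ≤ β‖O‖² · 4‖q‖² · 27(2ρ₀+1) · [S_Ψ · 32(1 + log(N + ρ₀ + 1))/M² + 4|t_⊥| (2N+1)²]`
(`q = n_↑ + n_↓` at the origin, `S_Ψ = Σ_{X∋0} ‖Φ(X)‖`). [cite: KleinLandauShucker1981] [cite: ArakiMoriya2003, Theorem 12.11] -/
theorem InfVolFermionState.IsVarEquilibrium.norm_sq_expect_le_stacked (h : ω.IsVarEquilibrium β (stackedHubbardInteraction t t' tp U μ) 1)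
    {Λ : Finset (Site 3)} {ρ₀ : ℕ} (hΛ : Λ ⊆ box 3 ρ₀) (O : FermionOp Λ) {κ : ℂ}
    (hO : (totalNumber : FermionOp Λ) * O - O * totalNumber = κ • O)
    {a N : ℕ} (ha : ρ₀ + 4 ≤ a) {M : ℝ} (hM : 0 < M) (haN : (a : ℝ) * Real.exp M ≤ N) :
    ‖κ‖ ^ 2 * ‖ω.expect Λ O‖ ^ 2 ≤ β * ‖O‖ ^ 2 * (4 * ‖numberCharge 3‖ ^ 2 * (27 * (2 * ρ₀ + 1) *
      ((∑ X ∈ (thicken ({0} : Finset (Site 3)) 1).powerset with (0 : Site 3) ∈ X, ‖(stackedHubbardInteraction t t' tp U μ).Φ X‖) *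
          (32 * (1 + Real.log ((N + ρ₀ + 1 : ℕ) : ℝ)) / M ^ 2) +
        4 * |tp| * (2 * (N : ℝ) + 1) ^ 2))) := by
  have hmain := h.norm_sq_expect_le_layered (stackedHubbardInteraction_isHermitian t t' tp U μ)
    (stackedHubbardInteraction_isEven t t' tp U μ) (stackedHubbardInteraction_isTranslationInvariant t t' tp U μ)
    (stackedHubbardInteraction_hasFiniteRange t t' tp U μ) hβ (numberCharge_isHermitian 3) (parityAut_numberCharge 3)
    (commute_chargeSum_numberCharge_stacked t t' tp U μ) hΛ O (κ := κ) (by rw [chargeSum_numberCharge]; exact hO)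
    (a := a) (N := N) (by rw [Nat.floor_one]; omega) hM haN
  rw [Nat.floor_one, card_box] at hmain
  have e27 : (((2 * 1 + 1) ^ 3 : ℕ) : ℝ) = 27 := by norm_num
  rw [e27] at hmain
  simp only [Nat.cast_one, one_pow, mul_one] at hmain
  have hE := interlayerNorm_stacked_le t t' tp U μ 1
  refine hmain.trans ?_
  gcongr

/-- **THE PAIRING AMPLITUDE OF WEAKLY COUPLED HUBBARD LAYERS**: in every translation-invariant equilibrium state of the stacked
`t–t'–t_⊥` Hubbard model, for all orbitals `p, q` of a region `Λ ⊆ box ρ₀` and all `a ≥ ρ₀ + 4`, `M > 0`, `N ≥ a e^M`,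
`4|ω(c_p c_q)|² ≤ β · 4‖q‖² · 27(2ρ₀+1) · [S_Ψ · 32(1 + log(N + ρ₀ + 1))/M² + 4|t_⊥| (2N+1)²]`; with `e^{2M} ≍ |t_⊥|^{-1/2}`
the right side is `O(β/log(1/|t_⊥|))` — a pairing amplitude `m₀` needs `β ≳ m₀² log(1/|t_⊥|)`.
[cite: KleinLandauShucker1981] [cite: KomaTasakiPRL1992, p. 3] -/
theorem InfVolFermionState.IsVarEquilibrium.norm_sq_expect_pair_le_stacked (h : ω.IsVarEquilibrium β (stackedHubbardInteraction t t' tp U μ) 1)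
    {Λ : Finset (Site 3)} {ρ₀ : ℕ} (hΛ : Λ ⊆ box 3 ρ₀) (p q : Orb (PolySite Λ))
    {a N : ℕ} (ha : ρ₀ + 4 ≤ a) {M : ℝ} (hM : 0 < M) (haN : (a : ℝ) * Real.exp M ≤ N) :
    4 * ‖ω.expect Λ (annihilation p * annihilation q)‖ ^ 2 ≤ β * (4 * ‖numberCharge 3‖ ^ 2 * (27 * (2 * ρ₀ + 1) *
      ((∑ X ∈ (thicken ({0} : Finset (Site 3)) 1).powerset with (0 : Site 3) ∈ X, ‖(stackedHubbardInteraction t t' tp U μ).Φ X‖) *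
          (32 * (1 + Real.log ((N + ρ₀ + 1 : ℕ) : ℝ)) / M ^ 2) +
        4 * |tp| * (2 * (N : ℝ) + 1) ^ 2))) := by
  have hmain := h.norm_sq_expect_le_stacked t t' tp U μ hβ hΛ (annihilation p * annihilation q)
    (totalNumber_commutator_annihilation_mul_annihilation p q) ha hM haN
  have hκ : ‖(-2 : ℂ)‖ ^ 2 = 4 := by norm_num
  rw [hκ] at hmain
  have hO : ‖(annihilation p * annihilation q : FermionOp Λ)‖ ^ 2 ≤ 1 := by
    have h1 := (norm_mul_le (annihilation p : FermionOp Λ) (annihilation q)).trans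
      (mul_le_one₀ (norm_annihilation_le_one p) (norm_nonneg _) (norm_annihilation_le_one q))
    exact pow_le_one₀ (norm_nonneg _) h1
  refine hmain.trans ?_
  have hC : 0 ≤ 4 * ‖numberCharge 3‖ ^ 2 * (27 * (2 * ρ₀ + 1) *
      ((∑ X ∈ (thicken ({0} : Finset (Site 3)) 1).powerset with (0 : Site 3) ∈ X, ‖(stackedHubbardInteraction t t' tp U μ).Φ X‖) *
          (32 * (1 + Real.log ((N + ρ₀ + 1 : ℕ) : ℝ)) / M ^ 2) +
        4 * |tp| * (2 * (N : ℝ) + 1) ^ 2)) := by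
    have hS0 : 0 ≤ ∑ X ∈ (thicken ({0} : Finset (Site 3)) 1).powerset with (0 : Site 3) ∈ X,
        ‖(stackedHubbardInteraction t t' tp U μ).Φ X‖ := Finset.sum_nonneg fun _ _ => norm_nonneg _
    have hlog : 0 ≤ 1 + Real.log ((N + ρ₀ + 1 : ℕ) : ℝ) :=
      add_nonneg zero_le_one (Real.log_nonneg (by exact_mod_cast Nat.succ_le_succ (Nat.zero_le _)))
    positivity
  calc β * ‖(annihilation p * annihilation q : FermionOp Λ)‖ ^ 2 * _ ≤ β * 1 * _ :=
        mul_le_mul_of_nonneg_right (mul_le_mul_of_nonneg_left hO hβ) hC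
    _ = _ := by rw [mul_one]

end Stacked

end Literature.MathematicalPhysics.QuantumLattice

end
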